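import Summits.BirchSwinnertonDyer.BirchSwinnertonDyer.Theorems.PrintX10bTwoSidedLinkAnyClassNumberX10bOfPrintFactsPinnedLink
import Summits.BirchSwinnertonDyer.BirchSwinnertonDyer.Theorems.PrintX10bHowardContainmentAnyClassNumberX10bThm413Hyp
import Summits.BirchSwinnertonDyer.BirchSwinnertonDyer.Theorems.PrintX10bBeyondCarrierUpperLinkOfPrint
import HarnessLib

/-!
# The one-sided link U₃ on the `3 ∤ h_K` X10b frames through the PINNED road (REF-107 (c1)): Mastella–Zerman
# Cor. 4.6 for a Heegner family TIED to the frame's parametrisation, then the pinned class-number-free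
# two-sided link, then its `≤` half

HONEST FRAMING (cell `run/shared/lean/pub/bsd-print-x9/`, D-0154 row 10 width seat `bsd-line-x10b-p1-w2`;
kernel witness for the lead's registered v5 stub `stub_upperLink_coprimeClassNumber` of crux
stmt-BirchSwinnertonDyer-23055 MODULO named facts — the stub itself stays open until the facts have `_holds`):
THEOREMS ONLY, route-free (no `Theses` import), nothing booked, nothing closed. «beyond-print theorem»: NO.
BSD is not proved by any of this.

WHY. My p608175 `UpperHalf.upperLinkX10b_coprimeClassNumber_of_namedFacts (h46 hYZ h331)` derives U₃ on the
`3 ∤ h_K` frames through the composite `hYZ` = `thm57_thm59_bcs422_cgls513_generator_constantCoeff_of_heegnerDivisibility`,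
which the cell referee classifies MISSTATED «layout: unpinned Heegner family» (REF-104 (Y1)). REF-107 (c1)
asks for the same derivation through the PINNED road already in the kernel: Howard's containment for a
family with `F.Dt = Dt` (`X10.heegnerContainmentPinned_of_cor46_of_not_surj`, x10b-p2 p607508, Mastella–Zerman
Cor. 4.6 at `3`, `3 ∤ h_K`) → the two-sided link from the PINNED class-number-free facts
(`CompositeTransferX10b.imcWaldspurgerOnTreeGoodAt_inducedPlace_of_printFacts_of_pinnedTransfer`, x10b-p3
p608225: `h57` Yan–Zhu Thm. 5.7 (1), `h59gp` the pinned (T2)-general transfer at `s = 1`, `h422` BCS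
Prop. 4.2.2, `h513` CGLS Thm. 5.1.3, `hC` Carayol, `h331` JSW Thm. 3.3.1) → its `≤` half
(`UpperHalf.upperLink_of_imcWaldspurgerOnTreeGoodAt`, p608175). This file is that composition.

WHAT. `upperLinkX10b_coprimeClassNumber_of_pinnedPrintFacts (h46) (h57) (h59gp) (h422) (h513) (hC) (h331)` —
U₃ (`∃ n, ord_3 f_ac(0) = n ∧ n ≤ 2·(ord_3 log_ω P + ord_3(1 − a_3 + 3) − 1)` for `X_ac = XAc (E_K) 3 κ
(inducedPlace ι) ∅ γ`) on every frame of the lead's stub `stub_upperLink_coprimeClassNumber` (X10b pair,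
`K` imaginary quadratic with odd `d_K ≠ −3`, Heegner for `N_E` and `3`, (irr_K), `3 ∤ h_K`, `ι κ γ`,
Manin-good `Dt`, `P ↦` the Heegner point of `(Dt, H)`, rank one, `Ш[3^∞]` finite, `P` non-torsion). The
embedding `jbar : K̄ → ℂ` for the tied family is `IsAlgClosed.lift` along `ιC`.

References: [MastellaZerman2026] Cor. 4.6; [YanZhu2024MainConjNonCM] Thm. 5.7 (1), Thm. 5.9;
[BurungaleCastellaSkinner2025] Prop. 4.2.2; [CastellaGrossiLeeSkinner2022] Thm. 5.1.3; [JetchevSkinnerWan2017]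
Thm. 3.3.1; [Castella2018] §5 (eq:IMC+BDP); REF-104 / REF-107 in `pub/bsd-print-x9/REF-AUDIT.md`.
-/

-- the REGISTERED stub namespace `Summit.BirchSwinnertonDyer.BirchSwinnertonDyer.Cruxes.…` repeats the summit name
set_option linter.dupNamespace false
set_option autoImplicit false

noncomputable section

open scoped Classical

open WeierstrassCurve NumberField IsDedekindDomain Field Literature.NumberTheory.EllipticCurves
  Literature.NumberTheory.EllipticCurves.ModularForms Literature.NumberTheory.EllipticCurves.Rank1Residual
  Literature.NumberTheory.EllipticCurves.Castella2018 Literature.NumberTheory.EllipticCurves.YanZhu2026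
  Literature.NumberTheory.EllipticCurves.CastellaGrossiLeeSkinner2022
  Literature.NumberTheory.EllipticCurves.JetchevSkinnerWan2017

open Summit.BirchSwinnertonDyer.Rank1Residual
open Summit.BirchSwinnertonDyer.BirchSwinnertonDyer.Rank1Residual (X10.heegnerContainmentPinned_of_cor46_of_not_surj)
open Summit.BirchSwinnertonDyer.BirchSwinnertonDyer.Cruxes.TwoSidedLinkAnyClassNumberX10b.CompositeTransferX10b
  (imcWaldspurgerOnTreeGoodAt_inducedPlace_of_printFacts_of_pinnedTransfer)

namespace Summit.BirchSwinnertonDyer.BirchSwinnertonDyer.Cruxes.BeyondCarrierDepthX10b.UpperHalf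

/-- **U₃ on the `3 ∤ h_K` frames through the PINNED road** (REF-107 (c1); kernel witness, modulo named facts,
of the lead's v5 stub `stub_upperLink_coprimeClassNumber` on crux 23055): Mastella–Zerman 2026 Cor. 4.6 at
`3` for a Heegner family TIED to `Dt` (`X10.heegnerContainmentPinned_of_cor46_of_not_surj`, needs `3 ∤ h_K`)
⟹ the two-sided link at the induced place from the pinned class-number-free facts
(`imcWaldspurgerOnTreeGoodAt_inducedPlace_of_printFacts_of_pinnedTransfer`) ⟹ its `≤` half
(`upperLink_of_imcWaldspurgerOnTreeGoodAt`). Facts: `h46` (MZ26 Cor. 4.6), `h57` (Yan–Zhu Thm. 5.7 (1)),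
`h59gp` (the pinned (T2)-general Heegner⟷BDP transfer at `s = 1`, stated inline as in p608225), `h422` (BCS
Prop. 4.2.2), `h513` (CGLS Thm. 5.1.3), `hC` (Carayol: newform level = conductor), `h331` (JSW Thm. 3.3.1).
[cite: MastellaZerman2026, Cor. 4.6] [cite: YanZhu2024MainConjNonCM, Thm. 5.7 (1) and Thm. 5.9]
[cite: BurungaleCastellaSkinner2025, Prop. 4.2.2] [cite: CastellaGrossiLeeSkinner2022, Thm. 5.1.3]
[cite: JetchevSkinnerWan2017, Thm. 3.3.1] [cite: Castella2018, §5 (eq:IMC+BDP)] -/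
theorem upperLinkX10b_coprimeClassNumber_of_pinnedPrintFacts
    (h46 : MastellaZerman2026.cor46_howardDivisibility_of_scalarImage.{0})
    (h57 : thm57_isTorsion_charIdealXGr_eq_bdpLFunction)
    (h59gp : ∀ {p : ℕ} [Fact p.Prime] (ι' : PadicAlgCl p ≃+* ℂ) (W : WeierstrassCurve ℚ) [W.IsElliptic]
      [W.IsGloballyMinimal] (K : Type) [Field K] [NumberField K] (v vbar : HeightOneSpectrum (𝓞 K))
      (κ : ZpExtension K p) (γ : absoluteGaloisGroup K) [Fact (κ.IsTopGenerator γ)] {N : ℕ} [NeZero N]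
      {f : CuspForm (CongruenceSubgroup.Gamma0 N) 2} (jbar : AlgebraicClosure K →+* ℂ)
      (_ : IsNewformOf W f),
      N = W.conductorNorm ℤ → 3 ≤ p → GoodOrd W p → (W.baseChange K).HasIrreducibleModPGaloisRep p →
      IsImaginaryQuadratic K → SatisfiesHeegnerHypothesis N K →
        ((Ideal.span {(p : ℤ)}).primesOver (𝓞 K)).ncard = 2 →
        Odd (NumberField.discr K) → NumberField.discr K ≠ -3 → κ.IsAnticyclotomic →
      (∀ (w : InfinitePlace K) (k : 𝓞 K), k ∈ v.asIdeal ↔ ‖ι'.symm (w.embedding (k : K))‖ < 1) →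
        ((p : ℕ) : 𝓞 K) ∈ vbar.asIdeal → vbar ≠ v →
      ∃ (ΩK : ℂ) (Ωp : (unrIntegers p)ˣ) (L : UnrSeries p),
        ΩK ≠ 0 ∧ IsBDPLFunction ι' v κ γ f ΩK ((Ωp : unrIntegers p) : ℂ_[p]) L ∧
        ∀ (D : (W.baseChange K).LambdaAdicSelmerData κ γ) (F : HeegnerFamily N W K κ jbar)
          (X : (W.baseChange K).SelmerDualData κ γ) (j : ℤ_[p] →+* unrIntegers p),
          ¬ (p : ℤ) ∣ F.Dt.c →
          (∀ x : ℤ_[p], ((j x : unrIntegers p) : ℂ_[p]) = algebraMap ℚ_[p] ℂ_[p] (x : ℚ_[p])) →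
          heegnerCharIdeal D F ^ 2 ≤
              Module.charIdeal (IwasawaAlgebra p) (Submodule.torsion (IwasawaAlgebra p) X.X) →
            L ∈ (AcSelmer.XAc.charIdeal (W.baseChange K) p κ vbar ∅ γ).map (PowerSeries.map j))
    (h422 : BurungaleCastellaSkinner2025.prop422_exists_isBDPLFunction_mu_eq_zero)
    (h513 : thm513_exists_isBDPLFunction_valueAtOne_disc)
    (hC : ∀ (N : ℕ) [NeZero N], IsNewformOf.level_eq_conductorNorm (N := N))
    (h331 : thm331_anticyclotomicControl) :
    ∀ (W : WeierstrassCurve ℚ) [W.IsElliptic] [W.IsGloballyMinimal] (p : ℕ) [Fact p.Prime]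
    [NeZero (W.conductorNorm ℤ)] (K : Type) [Field K] [NumberField K],
    Literature.NumberTheory.EllipticCurves.Rank1Residual.ClassX10 W p →
    ¬ Literature.NumberTheory.EllipticCurves.Rank1Residual.Surj W 3 → ¬ W.HasCM →
    Literature.NumberTheory.EllipticCurves.IsImaginaryQuadratic K → Odd (NumberField.discr K) →
    NumberField.discr K ≠ -3 →
    Literature.NumberTheory.EllipticCurves.SatisfiesHeegnerHypothesis (W.conductorNorm ℤ) K →
    Literature.NumberTheory.EllipticCurves.SatisfiesHeegnerHypothesis p K →
    (W.baseChange K).HasIrreducibleModPGaloisRep p → ¬ p ∣ NumberField.classNumber K →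
    ∀ (ι : K →+* ℚ_[p]) (κ : Literature.NumberTheory.EllipticCurves.ZpExtension K p), κ.IsAnticyclotomic →
    ∀ (γ : Field.absoluteGaloisGroup K) [Fact (κ.IsTopGenerator γ)]
      (Dt : Literature.NumberTheory.EllipticCurves.ModularForms.ModularParametrizationData W
        (W.conductorNorm ℤ)), ¬ (p : ℤ) ∣ Dt.c →
    ∀ (H : Literature.NumberTheory.EllipticCurves.HeegnerDatum (W.conductorNorm ℤ) (NumberField.discr K))
      (ιC : K →+* ℂ) (P : (W.baseChange K).toAffine.Point),
      WeierstrassCurve.Affine.Point.map ιC.toRatAlgHom P =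
        Literature.NumberTheory.EllipticCurves.ModularForms.heegnerPointComplex Dt H →
      (W.baseChange K).mordellWeilRank = 1 →
      Finite (AddCommGroup.primaryComponent (W.baseChange K).sha p) → ¬ IsOfFinAddOrder P →
    ∃ n : ℕ, Summit.BirchSwinnertonDyer.Rank1Residual.X11b.AcSelmer.XAc.HasCharValuationAt
        (W.baseChange K) p κ (Summit.BirchSwinnertonDyer.Rank1Residual.X11b.inducedPlace ι) ∅ γ n ∧
      (n : ℤ) ≤ 2 * (Summit.BirchSwinnertonDyer.Rank1Residual.X11b.padicLogOrd W p ι P +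
        (padicValInt p (1 - W.frobeniusTrace p + p) : ℤ) - 1) := by
  intro W _ _ p _ _ K _ _ hX hns hcm hK hodd h3 hHN hHp hirrK hhK ι κ hκ γ _ Dt hc H ιC P hP hrk hfinp hPinf
  obtain ⟨hp3, hord, -, -⟩ := id hX
  subst hp3
  have h4 : NumberField.discr K ≠ -4 := by
    rintro h
    rw [h] at hodd
    exact absurd hodd (by decide)
  -- an embedding `K̄ → ℂ` over `ιC` for the tied family
  letI : Algebra K ℂ := ιC.toAlgebra
  let jbar : AlgebraicClosure K →+* ℂ :=
    (IsAlgClosed.lift (R := K) (M := ℂ) (S := AlgebraicClosure K)).toRingHom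
  -- Howard's containment for a family TIED to `Dt` (Mastella–Zerman Cor. 4.6 at `3`, needs `3 ∤ h_K`)
  obtain ⟨D, F, X, hFD, -, hle⟩ := X10.heegnerContainmentPinned_of_cor46_of_not_surj h46 hX hns hcm hK h3
    h4 hHN hHp hhK κ hκ γ Fact.out Dt H jbar
  -- the pinned class-number-free two-sided link at the induced place, then its `≤` half
  exact upperLink_of_imcWaldspurgerOnTreeGoodAt
    (imcWaldspurgerOnTreeGoodAt_inducedPlace_of_printFacts_of_pinnedTransfer h57 h59gp h422 h513 hC h331
      le_rfl hord hK hodd h3 rfl hHN hHp hirrK ι κ hκ γ Dt hc H ιC P hP hrk hfinp hPinf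
      ⟨jbar, D, F, X, hFD, hle⟩)

end Summit.BirchSwinnertonDyer.BirchSwinnertonDyer.Cruxes.BeyondCarrierDepthX10b.UpperHalf

end
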